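import Literature.AlgebraicGeometry.Resolution.WeightedResolutionDatum

/-!
# No infinite centre-escape chains in a weighted resolution datum

Helper (lever) for crux `WeightedConstruction` (stmt-ResolutionOfSingularities-0571), route
`ResolutionOfSingularities/WeightedInvariant`; lead a2, 2026-08-17.

Two elementary consequences of axiom `(iii)` (`support_centre`: under the guard, the support of
the centre is the maximum locus of `inv`) and of the well-foundedness of the value set `Γ`, valid
for an ARBITRARY datum `D : WeightedResolutionDatum p`:

* `inv_lt_of_not_mem_support_centre_of_mem`: a point outside the support of the centre has `inv`
  strictly below a point inside it;
* `WeightedResolutionDatum_no_centreEscapeChain`: there is no sequence of pairs `(Yᵢ, Xᵢ)`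
  (possibly over varying perfect ground fields) with points `aᵢ` INSIDE and `bᵢ` OUTSIDE the
  support of the centre such that `inv aᵢ₊₁ ≤ inv bᵢ` for all `i` (the "transfer", supplied in
  applications by axiom `(i)` for open immersions, e.g. when `Yᵢ = Uᵢ ⊔ Uᵢ₊₁` is a disjoint
  union and `aᵢ₊₁`, `bᵢ` are the same point of `Uᵢ₊₁`).

The second is the formal core of the remark (lead a2, `Cruxes/WeightedConstruction/Lines/
a2-payload-lines-dead.md` §4) that the Abramovich–Temkin–Włodarczyk centre functor taken verbatim
cannot be the `centre` of any datum even in characteristic `0`: on the disjoint unions of the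
Brieskorn–Pham germs `x₁² + x₂^{b₂} + ⋯ + x_k^{b_k}` its supports realise exactly such a chain,
because ATW's lexicographic values `(2,3) > (2,2,5) > (2,2,4,7) > ⋯` descend for ever across
dimensions.
-/

noncomputable section

open CategoryTheory AlgebraicGeometry

open Literature.AlgebraicGeometry.Resolution

set_option linter.dupNamespace false -- mandated namespace of this single-conjunct summit

namespace Summit.ResolutionOfSingularities.ResolutionOfSingularities.Theorems

variable {p : ℕ} (D : WeightedResolutionDatum p)

section OnePair

variable {k : Type} [Field k] [CharP k p] [PerfectField k]
  {Y : Scheme.{0}} (f : Y ⟶ Spec (.of k)) [Smooth f] [IsSeparated f] [QuasiCompact f]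

/-- **Outside the centre, `inv` is strictly smaller than inside it.** Under the guard of `(iii)`,
if `a` lies in the support of the centre of `(Y, X)` and `b` does not, then `inv b < inv a`
(the support is the maximum locus of `inv`, `support_centre`, and `Γ` is linearly ordered).
[folklore] -/
theorem inv_lt_of_not_mem_support_centre_of_mem (X : Y.IdealSheafData)
    (hguard : ∃ y : Y, ¬ IsBot (D.inv f X y)) {a b : Y}
    (ha : a ∈ (D.centre f X).support) (hb : b ∉ (D.centre f X).support) :
    D.inv f X b < D.inv f X a := by
  rw [D.support_centre f X hguard] at ha hb
  simp only [Set.mem_setOf_eq, not_forall, not_le] at ha hb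
  obtain ⟨y', hy'⟩ := hb
  exact lt_of_lt_of_le hy' (ha y')

end OnePair

/-- **No infinite centre-escape chain.** For a datum `D` there is no sequence of pairs
`(Yᵢ → Spec kᵢ, Xᵢ)` in the regime of the axioms (perfect `kᵢ` of characteristic `p`, `Yᵢ` smooth
separated quasi-compact), each satisfying the guard, with points `aᵢ` in the support of the centre
and `bᵢ` outside it, such that `inv aᵢ₊₁ ≤ inv bᵢ` for every `i`: by
`inv_lt_of_not_mem_support_centre_of_mem` the values `inv aᵢ` would strictly decrease, against the
well-foundedness of `Γ`. (Used with `Yᵢ` a disjoint union of two germs and the transfer given by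
axiom `(i)` for the two open immersions, it says: a datum cannot keep, on all pairs, the centres of
a functor whose realised values contain an infinite strictly descending chain — e.g. ATW's
lexicographic invariant across all dimensions.) [folklore] -/
theorem WeightedResolutionDatum_no_centreEscapeChain (k : ℕ → Type) [∀ i, Field (k i)]
    [∀ i, CharP (k i) p] [∀ i, PerfectField (k i)] (Y : ℕ → Scheme.{0})
    (f : ∀ i, Y i ⟶ Spec (.of (k i)))
    [∀ i, Smooth (f i)] [∀ i, IsSeparated (f i)] [∀ i, QuasiCompact (f i)]
    (X : ∀ i, (Y i).IdealSheafData) (a b : ∀ i, Y i)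
    (hguard : ∀ i, ∃ y : Y i, ¬ IsBot (D.inv (f i) (X i) y))
    (ha : ∀ i, a i ∈ (D.centre (f i) (X i)).support)
    (hb : ∀ i, b i ∉ (D.centre (f i) (X i)).support)
    (htransfer : ∀ i, D.inv (f (i + 1)) (X (i + 1)) (a (i + 1)) ≤ D.inv (f i) (X i) (b i)) :
    False := by
  have hlt : ∀ i, D.inv (f (i + 1)) (X (i + 1)) (a (i + 1)) < D.inv (f i) (X i) (a i) :=
    fun i => (htransfer i).trans_lt
      (inv_lt_of_not_mem_support_centre_of_mem D (f i) (X i) (hguard i) (ha i) (hb i))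
  obtain ⟨n, hn⟩ :=
    WellFounded.not_rel_apply_succ (r := (· < ·)) (fun i => D.inv (f i) (X i) (a i))
  exact hn (hlt n)

end Summit.ResolutionOfSingularities.ResolutionOfSingularities.Theorems

end
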